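import Literature.NumberTheory.Automorphic.ArchInnerFormChartLocal           -- ★ FILE G1 (LH3-p03 (g3)): `gprimeBlockAt`, `chartTorusGLoc`, `chartBoxImgGLoc`, `forall_mem_chartTorusGLoc_comm`; brings ★ `chartOrbG`, ★ `quotientMeasure_eq_inv_smul_of_eq_smul`
import Literature.MeasureTheory.Group.InvariantQuotientCompactSubgroup      -- ★ `integral_quotientMeasure_eq_inv_smul` (compact subgroup)
import Mathlib.MeasureTheory.Measure.Haar.Unique
import HarnessLib

/-!
# The local `G′` chart orbital functional `chartOrbGLoc` on `U(α)_w` modulo `T′_{S′,w}`; Haar-freeness of ★ `chartOrbG`; the compact place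
# ((PROD-QUOT-G′) FILE G2 of the LH3 direct road — the `G′`-side twin of ★ `ArchEndoscopicChartOrbLocal` ∕ `…OrbPlaces` §4: Rogawski 1990 §8.2–8.3; Shelstad 1979 §4;
# Deitmar–Echterhoff 2014 Thm. 1.5.3, Cor. 1.5.4; Folland 1995 §2.2, §2.6)

Topic `NumberTheory/Automorphic`; namespace `Literature.NumberTheory.Automorphic.UnitaryGroup`.  DEFINITIONS WITH BODIES (`chartHaarGLoc`, `chartQuotientMeasureGLoc`, `chartOrbGLoc`)
+ theorems; no instance, no notation, no axiom, no named fact, no `sorry`.  Cell `pub/hodgecm-mathlib`, crux H413 (`stmt-HodgeConjecture-24833`), F0∕P3c line LH3 (closer stub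
`stub_N9`, DIRECT ROAD), organ «(PROD-QUOT-G′)» (LH3-p03 (g3)); count-neutral.
* §1 **`chartHaarGLoc`** (auxiliary Haar on `T′_{S′,w}`; Haar ∕ regular ∕ left- and inversion-invariant ∕ finite on compacts ∕ open-positive ∕ σ-finite),
  **`chartQuotientMeasureGLoc L α w S′ ν_w`** (★ `quotientMeasure`, Borel inside), **`chartOrbGLoc L α w S′ ν_w f cw := dt′_w(B′_{S′,w}) · ∫_{U(α)_w ⧸ T′_{S′,w}} f(x·gprimeBlockAt cw·x⁻¹) d(ν_w∕dt′_w)`**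
  (Haar-free by the prefactor, (δ3) one place at a time), `chartOrbGLoc_def ∕ _congr ∕ _zero`, **`chartOrbGLoc_eq_of_isHaarMeasure`**.
* §2 **`chartOrbG_eq_of_isHaarMeasure`** — HAAR-FREENESS OF THE GLOBAL ★ `chartOrbG` (the `G′` twin of ★ `chartOrbH_eq_of_isHaarMeasure`, which the tree lacked): for ANY
  inversion-invariant Haar `t` on `T_{S′}`, `chartOrbG = t(B′) · ∫ … d(ν′∕t)`.
* §3 THE COMPACT PLACE `w ∉ S′`: `gprimeBlockAt_eq_of_not_mem_of_circleExp_eq` (the unit-diagonal chart reads all three slots through `e^{i·}`), **`chartBoxImgGLoc_eq_univ_of_not_mem`**,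
  **`compactSpace_chartTorusGLoc_of_not_mem`**, **`chartOrbGLoc_eq_integral_of_not_mem : chartOrbGLoc L α w S′ ν_w f cw = ∫_{U(α)_w} f(h·gprimeBlockAt cw·h⁻¹) dν_w`** (no constant:
  the prefactor cancels ★ `integral_quotientMeasure_eq_inv_smul` exactly) — the whole-`U(α)_w` currency in which (J-DESC) descends to `Z(s) ⊇ U(1,1)`.
HONEST LABEL: HC_CM is proved only modulo the 7 printed citations (2 remaining: hLiu418 = `stmt-HodgeConjecture-24832`, h413 = `stmt-HodgeConjecture-24833`) until rung 0
closes; measure bookkeeping, moves no row of the books.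

## References
* [Rogawski1990] J. D. Rogawski, *Automorphic Representations of Unitary Groups in Three Variables*, Ann. of Math. Stud. 123 (1990), §3.6 p. 31, §8.2 p. 122, §8.3 p. 124.
* [Shelstad1979] D. Shelstad, *Characters and inner forms of a quasi-split group over ℝ*, Compositio Math. 39 (1979), §4 p. 22.
* [DeitmarEchterhoff2014] A. Deitmar, S. Echterhoff, *Principles of Harmonic Analysis*, 2nd ed. (2014), Thm. 1.5.3, Cor. 1.5.4.
* [Folland1995] G. B. Folland, *A Course in Abstract Harmonic Analysis* (1995), §2.2, §2.6 Thm. 2.49, (2.52).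
-/

set_option autoImplicit false

noncomputable section

open MeasureTheory MeasureTheory.Measure NumberField NumberField.InfinitePlace Matrix Complex Topology
open Literature.MeasureTheory.Group
open scoped MatrixGroups Matrix Classical ENNReal NNReal

namespace Literature.NumberTheory.Automorphic.UnitaryGroup

/-! ## §1 The local Haar measure, the local quotient measure, the local functional -/

section LocalOrb

variable (L : Type) [Field L] [NumberField L] [IsCMField L] (α : Fin 3 → L) (w : {w : InfinitePlace L // IsComplex w}) (S' : Finset {w : InfinitePlace L // IsComplex w})
  [MeasurableSpace ↥(archLocal L 3 (Matrix.diagonal α) w)] [BorelSpace ↥(archLocal L 3 (Matrix.diagonal α) w)]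

/-- **The auxiliary Haar measure `dt′_w` of `T′_{S′,w}`** (Mathlib `haarMeasure` at a fixed positive compact); consumers read `chartOrbGLoc`, which is independent of this choice.
[cite: Folland1995, §2.2] [cite: Shelstad1979, §4 p. 22] -/
def chartHaarGLoc : Measure ↥(chartTorusGLoc L α w S') :=
  haveI := locallyCompactSpace_chartTorusGLoc L α w S'
  haarMeasure (Classical.arbitrary (TopologicalSpace.PositiveCompacts ↥(chartTorusGLoc L α w S')))

/-- `dt′_w` is a Haar measure. [cite: Folland1995, §2.2] -/
theorem isHaarMeasure_chartHaarGLoc : (chartHaarGLoc L α w S').IsHaarMeasure := by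
  haveI := locallyCompactSpace_chartTorusGLoc L α w S'
  unfold chartHaarGLoc
  infer_instance

/-- `dt′_w` is regular. [cite: Folland1995, §2.2] -/
theorem regular_chartHaarGLoc : (chartHaarGLoc L α w S').Regular := by
  haveI := locallyCompactSpace_chartTorusGLoc L α w S'
  haveI := secondCountableTopology_archLocal_three L α w
  unfold chartHaarGLoc
  infer_instance

/-- `dt′_w` is inversion invariant (`T′_{S′,w}` is abelian). [cite: Folland1995, §2.2; §2.6 Thm. 2.49] -/
theorem isInvInvariant_chartHaarGLoc : (chartHaarGLoc L α w S').IsInvInvariant := by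
  haveI := locallyCompactSpace_chartTorusGLoc L α w S'
  haveI := isHaarMeasure_chartHaarGLoc L α w S'
  haveI := regular_chartHaarGLoc L α w S'
  letI : CommGroup ↥(chartTorusGLoc L α w S') := { (inferInstance : Group ↥(chartTorusGLoc L α w S')) with mul_comm := chartTorusGLoc_mul_comm L α w S' }
  exact IsHaarMeasure.isInvInvariant_of_regular (chartHaarGLoc L α w S')

/-- `dt′_w` is σ-finite. [cite: Folland1995, §2.2] -/
theorem sigmaFinite_chartHaarGLoc : SigmaFinite (chartHaarGLoc L α w S') := by
  haveI := locallyCompactSpace_chartTorusGLoc L α w S'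
  haveI := secondCountableTopology_archLocal_three L α w
  haveI : SecondCountableTopology ↥(chartTorusGLoc L α w S') := TopologicalSpace.Subtype.secondCountableTopology _
  haveI := isHaarMeasure_chartHaarGLoc L α w S'
  exact IsHaarMeasure.sigmaFinite _

/-- `dt′_w(B′_{S′,w}) < ∞`. [cite: Folland1995, §2.2] -/
theorem chartHaarGLoc_chartBoxImgGLoc_lt_top : chartHaarGLoc L α w S' (chartBoxImgGLoc L α w S') < ⊤ :=
  haveI := isHaarMeasure_chartHaarGLoc L α w S'
  (isCompact_chartBoxImgGLoc L α w S').measure_lt_top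

variable (νw : Measure ↥(archLocal L 3 (Matrix.diagonal α) w)) [νw.IsHaarMeasure] [νw.IsMulRightInvariant]

/-- **The local chart quotient measure `dν_w ∕ dt′_w` on `U(α)_w ⧸ T′_{S′,w}`** (★ `quotientMeasure`; Borel σ-algebra fixed inside). [cite: DeitmarEchterhoff2014, Thm. 1.5.3] -/
def chartQuotientMeasureGLoc : @Measure (↥(archLocal L 3 (Matrix.diagonal α) w) ⧸ chartTorusGLoc L α w S') (borel _) := by
  letI : MeasurableSpace (↥(archLocal L 3 (Matrix.diagonal α) w) ⧸ chartTorusGLoc L α w S') := borel _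
  haveI : BorelSpace (↥(archLocal L 3 (Matrix.diagonal α) w) ⧸ chartTorusGLoc L α w S') := ⟨rfl⟩
  haveI := locallyCompactSpace_archLocal_three L α w
  haveI := secondCountableTopology_archLocal_three L α w
  haveI := isHaarMeasure_chartHaarGLoc L α w S'
  haveI := isInvInvariant_chartHaarGLoc L α w S'
  exact quotientMeasure (chartTorusGLoc L α w S') (chartHaarGLoc L α w S') (isClosed_chartTorusGLoc L α w S') νw

/-- **THE LOCAL `G′` CHART ORBITAL FUNCTIONAL** `chartOrbGLoc L α w S′ ν_w f cw := dt′_w(B′_{S′,w}) · ∫_{U(α)_w ⧸ T′_{S′,w}} f(x · gprimeBlockAt cw · x⁻¹) d(ν_w ∕ dt′_w)(x̄)`, at EVERY `cw`;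
Haar-free by the box-mass prefactor; the `w`-factor of ★ `chartOrbG` on product test functions (sibling `ArchInnerFormChartOrbPlaces`). [cite: Rogawski1990, §8.2 p. 122; §8.3 p. 124]
[cite: DeitmarEchterhoff2014, Thm. 1.5.3] -/
def chartOrbGLoc (f : ↥(archLocal L 3 (Matrix.diagonal α) w) → ℂ) (cw : Fin 3 → ℝ) : ℂ := by
  letI : MeasurableSpace (↥(archLocal L 3 (Matrix.diagonal α) w) ⧸ chartTorusGLoc L α w S') := borel _
  exact ((chartHaarGLoc L α w S' (chartBoxImgGLoc L α w S')).toReal : ℂ) *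
    ∫ x, descConj (gprimeBlockAt L α w S' cw) (chartTorusGLoc L α w S') (forall_mem_chartTorusGLoc_comm L α w S' cw) f x ∂(chartQuotientMeasureGLoc L α w S' νw)

/-- `chartOrbGLoc` unfolded (definitional). [cite: Rogawski1990, §8.2 p. 122] -/
theorem chartOrbGLoc_def (f : ↥(archLocal L 3 (Matrix.diagonal α) w) → ℂ) (cw : Fin 3 → ℝ) :
    chartOrbGLoc L α w S' νw f cw =
      (letI : MeasurableSpace (↥(archLocal L 3 (Matrix.diagonal α) w) ⧸ chartTorusGLoc L α w S') := borel _
       ((chartHaarGLoc L α w S' (chartBoxImgGLoc L α w S')).toReal : ℂ) *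
         ∫ x, descConj (gprimeBlockAt L α w S' cw) (chartTorusGLoc L α w S') (forall_mem_chartTorusGLoc_comm L α w S' cw) f x ∂(chartQuotientMeasureGLoc L α w S' νw)) := rfl

/-- **`chartOrbGLoc` depends on `cw` only through the local chart point.** [cite: Rogawski1990, §8.2 p. 122] -/
theorem chartOrbGLoc_congr (f : ↥(archLocal L 3 (Matrix.diagonal α) w) → ℂ) {cw cw' : Fin 3 → ℝ} (h : gprimeBlockAt L α w S' cw = gprimeBlockAt L α w S' cw') :
    chartOrbGLoc L α w S' νw f cw = chartOrbGLoc L α w S' νw f cw' := by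
  rw [chartOrbGLoc_def, chartOrbGLoc_def]
  have hint : descConj (gprimeBlockAt L α w S' cw) (chartTorusGLoc L α w S') (forall_mem_chartTorusGLoc_comm L α w S' cw) f =
      descConj (gprimeBlockAt L α w S' cw') (chartTorusGLoc L α w S') (forall_mem_chartTorusGLoc_comm L α w S' cw') f := by
    funext y
    induction y using QuotientGroup.induction_on with
    | H g => rw [descConj_mk, descConj_mk, h]
  rw [hint]

/-- `chartOrbGLoc … 0 cw = 0`. [cite: Rogawski1990, §8.2 p. 122] -/
theorem chartOrbGLoc_zero (cw : Fin 3 → ℝ) : chartOrbGLoc L α w S' νw 0 cw = 0 := by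
  rw [chartOrbGLoc_def]
  have h : descConj (gprimeBlockAt L α w S' cw) (chartTorusGLoc L α w S') (forall_mem_chartTorusGLoc_comm L α w S' cw)
      (0 : ↥(archLocal L 3 (Matrix.diagonal α) w) → ℂ) = 0 := by
    funext y
    induction y using QuotientGroup.induction_on
    rfl
  rw [h]
  simp only [Pi.zero_apply, integral_zero, mul_zero]

/-- **HAAR-FREENESS OF THE LOCAL FUNCTIONAL**: for ANY inversion-invariant Haar `t` on `T′_{S′,w}`, `chartOrbGLoc = t(B′_{S′,w}) · ∫ … d(ν_w ∕ t)`
(★ `quotientMeasure_eq_inv_smul_of_eq_smul`). [cite: Folland1995, §2.2; §2.6 Thm. 2.49] [cite: DeitmarEchterhoff2014, Thm. 1.5.3] -/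
theorem chartOrbGLoc_eq_of_isHaarMeasure (t : Measure ↥(chartTorusGLoc L α w S')) [t.IsHaarMeasure] [t.IsInvInvariant]
    (f : ↥(archLocal L 3 (Matrix.diagonal α) w) → ℂ) (cw : Fin 3 → ℝ) :
    chartOrbGLoc L α w S' νw f cw =
      (letI : MeasurableSpace (↥(archLocal L 3 (Matrix.diagonal α) w) ⧸ chartTorusGLoc L α w S') := borel _
       haveI : BorelSpace (↥(archLocal L 3 (Matrix.diagonal α) w) ⧸ chartTorusGLoc L α w S') := ⟨rfl⟩
       haveI := locallyCompactSpace_archLocal_three L α w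
       haveI := secondCountableTopology_archLocal_three L α w
       ((t (chartBoxImgGLoc L α w S')).toReal : ℂ) *
         ∫ x, descConj (gprimeBlockAt L α w S' cw) (chartTorusGLoc L α w S') (forall_mem_chartTorusGLoc_comm L α w S' cw) f x
           ∂(quotientMeasure (chartTorusGLoc L α w S') t (isClosed_chartTorusGLoc L α w S') νw)) := by
  letI : MeasurableSpace (↥(archLocal L 3 (Matrix.diagonal α) w) ⧸ chartTorusGLoc L α w S') := borel _
  haveI : BorelSpace (↥(archLocal L 3 (Matrix.diagonal α) w) ⧸ chartTorusGLoc L α w S') := ⟨rfl⟩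
  haveI := locallyCompactSpace_archLocal_three L α w
  haveI := secondCountableTopology_archLocal_three L α w
  haveI := locallyCompactSpace_chartTorusGLoc L α w S'
  haveI := isHaarMeasure_chartHaarGLoc L α w S'
  haveI := isInvInvariant_chartHaarGLoc L α w S'
  set κ : ℝ≥0 := haarScalarFactor t (chartHaarGLoc L α w S') with hκdef
  have hκ : κ ≠ 0 := (haarScalarFactor_pos_of_isHaarMeasure t (chartHaarGLoc L α w S')).ne'
  have ht : t = κ • chartHaarGLoc L α w S' := isMulLeftInvariant_eq_smul t (chartHaarGLoc L α w S')
  have hQ := quotientMeasure_eq_inv_smul_of_eq_smul (chartTorusGLoc L α w S') (isClosed_chartTorusGLoc L α w S') (chartHaarGLoc L α w S') t νw hκ ht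
  rw [chartOrbGLoc_def]
  show ((chartHaarGLoc L α w S' (chartBoxImgGLoc L α w S')).toReal : ℂ) *
      ∫ x, descConj (gprimeBlockAt L α w S' cw) (chartTorusGLoc L α w S') (forall_mem_chartTorusGLoc_comm L α w S' cw) f x
        ∂(quotientMeasure (chartTorusGLoc L α w S') (chartHaarGLoc L α w S') (isClosed_chartTorusGLoc L α w S') νw) = _
  rw [hQ, integral_smul_nnreal_measure, ht, Measure.smul_apply, ENNReal.smul_def, smul_eq_mul, ENNReal.toReal_mul, ENNReal.coe_toReal,
    NNReal.smul_def, Complex.real_smul, NNReal.coe_inv, Complex.ofReal_mul, Complex.ofReal_inv]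
  have hκC : ((κ : ℝ) : ℂ) ≠ 0 := by exact_mod_cast hκ
  field_simp

end LocalOrb

/-! ## §2 Haar-freeness of the global ★ `chartOrbG` -/

section Free

variable (L : Type) [Field L] [NumberField L] [IsCMField L] (α : Fin 3 → L) (S' : Finset {w : InfinitePlace L // IsComplex w})
  [MeasurableSpace ↥(arch (↥(maximalRealSubfield L)) L (IsCMField.complexConj L) 3 (Matrix.diagonal α))] [BorelSpace ↥(arch (↥(maximalRealSubfield L)) L (IsCMField.complexConj L) 3 (Matrix.diagonal α))]
  (ν' : Measure ↥(arch (↥(maximalRealSubfield L)) L (IsCMField.complexConj L) 3 (Matrix.diagonal α))) [ν'.IsHaarMeasure] [ν'.IsMulRightInvariant]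

/-- **HAAR-FREENESS OF ★ `chartOrbG`** (the `G′` twin of ★ `chartOrbH_eq_of_isHaarMeasure`): for ANY inversion-invariant Haar measure `t` on `T_{S′}`,
`chartOrbG ν′ S′ a′ c = t(B′) · ∫_{G′_∞ ⧸ T_{S′}} a′(y · gprimeTorus S′ c · y⁻¹) d(ν′ ∕ t)(ȳ)` (`t = κ • dt′`, `ν′∕t = κ⁻¹ • (ν′∕dt′)`, `κ κ⁻¹ = 1`).
[cite: Folland1995, §2.2; §2.6 Thm. 2.49] [cite: DeitmarEchterhoff2014, Thm. 1.5.3] [cite: Rogawski1990, §8.2 p. 122] -/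
theorem chartOrbG_eq_of_isHaarMeasure (t : Measure ↥(chartTorusG L α S')) [t.IsHaarMeasure] [t.IsInvInvariant]
    (a' : ↥(arch (↥(maximalRealSubfield L)) L (IsCMField.complexConj L) 3 (Matrix.diagonal α)) → ℂ) (c : {w : InfinitePlace L // IsComplex w} → Fin 3 → ℝ) :
    chartOrbG L α ν' S' a' c =
      (letI : MeasurableSpace (↥(arch (↥(maximalRealSubfield L)) L (IsCMField.complexConj L) 3 (Matrix.diagonal α)) ⧸ chartTorusG L α S') := borel _
       haveI : BorelSpace (↥(arch (↥(maximalRealSubfield L)) L (IsCMField.complexConj L) 3 (Matrix.diagonal α)) ⧸ chartTorusG L α S') := ⟨rfl⟩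
       ((t (chartBoxImgG L α S')).toReal : ℂ) *
         ∫ y, descConj (gprimeTorus L α S' c) (chartTorusG L α S') (forall_mem_chartTorusG_comm L α S' c) a' y ∂(quotientMeasure (chartTorusG L α S') t (isClosed_chartTorusG L α S') ν')) := by
  letI : MeasurableSpace (↥(arch (↥(maximalRealSubfield L)) L (IsCMField.complexConj L) 3 (Matrix.diagonal α)) ⧸ chartTorusG L α S') := borel _
  haveI : BorelSpace (↥(arch (↥(maximalRealSubfield L)) L (IsCMField.complexConj L) 3 (Matrix.diagonal α)) ⧸ chartTorusG L α S') := ⟨rfl⟩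
  haveI := locallyCompactSpace_chartTorusG L α S'
  haveI := isHaarMeasure_chartHaarG L α S'
  haveI := isInvInvariant_chartHaarG L α S'
  set κ : ℝ≥0 := haarScalarFactor t (chartHaarG L α S') with hκdef
  have hκ : κ ≠ 0 := (haarScalarFactor_pos_of_isHaarMeasure t (chartHaarG L α S')).ne'
  have ht : t = κ • chartHaarG L α S' := isMulLeftInvariant_eq_smul t (chartHaarG L α S')
  have hQ := quotientMeasure_eq_inv_smul_of_eq_smul (chartTorusG L α S') (isClosed_chartTorusG L α S') (chartHaarG L α S') t ν' hκ ht
  rw [chartOrbG_def]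
  show ((chartHaarG L α S' (chartBoxImgG L α S')).toReal : ℂ) *
      ∫ y, descConj (gprimeTorus L α S' c) (chartTorusG L α S') (forall_mem_chartTorusG_comm L α S' c) a' y
        ∂(quotientMeasure (chartTorusG L α S') (chartHaarG L α S') (isClosed_chartTorusG L α S') ν') = _
  rw [hQ, integral_smul_nnreal_measure, ht, Measure.smul_apply, ENNReal.smul_def, smul_eq_mul, ENNReal.toReal_mul, ENNReal.coe_toReal,
    NNReal.smul_def, Complex.real_smul, NNReal.coe_inv, Complex.ofReal_mul, Complex.ofReal_inv]
  have hκC : ((κ : ℝ) : ℂ) ≠ 0 := by exact_mod_cast hκ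
  field_simp

end Free

/-! ## §3 The compact place `w ∉ S′`: the local functional is the whole-group orbital integral -/

section CompactPlace

variable (L : Type) [Field L] [NumberField L] [IsCMField L] (α : Fin 3 → L) (w : {w : InfinitePlace L // IsComplex w}) (S' : Finset {w : InfinitePlace L // IsComplex w})

omit [NumberField L] [IsCMField L] in
/-- `e^{i·toIcoMod(x)} = e^{ix}` (reducing an angle into `[0, 2π)`). [cite: Folland1995, §2.2] -/
private theorem circleExp_toIcoMod' (x : ℝ) : Circle.exp (toIcoMod Real.two_pi_pos 0 x) = Circle.exp x := by
  rw [Circle.exp_eq_exp]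
  exact ⟨-toIcoDiv Real.two_pi_pos 0 x, by rw [toIcoMod, zsmul_eq_mul]; push_cast; ring⟩

omit [NumberField L] [IsCMField L] in
/-- At `w ∉ S′` the local chart is the unit diagonal `gprimeCptGL (lineOf s) cw`, which reads its three slots through `e^{i·}`: equal circle points give equal chart points.
[cite: Rogawski1990, §3.6 p. 31; §4.9 p. 54] -/
theorem gprimeBlockAt_eq_of_not_mem_of_circleExp_eq (hw : w ∉ S') {cw cw' : Fin 3 → ℝ} (h : ∀ k, Circle.exp (cw k) = Circle.exp (cw' k)) :
    gprimeBlockAt L α w S' cw = gprimeBlockAt L α w S' cw' := by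
  apply Subtype.ext
  rw [gprimeBlockAt, gprimeBlockAt, coe_gprimeBlock_of_not_mem L α _ hw, coe_gprimeBlock_of_not_mem L α _ hw]
  unfold gprimeCptGL
  exact congrArg _ (funext fun ℓ => h _)

/-- **At `w ∉ S′` the local box image is the WHOLE local torus** (all three slots are angles in `[0, 2π]`; frame hypotheses for ★ `mem_chartTorusGLoc_iff`).
[cite: Rogawski1990, §3.6 p. 31] [cite: Folland1995, §2.2] -/
theorem chartBoxImgGLoc_eq_univ_of_not_mem (hα : ∀ i, α i ≠ 0) (hS' : ∀ w, w ∈ S' → w ∈ splitChartPlaces L α) (hw : w ∉ S') :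
    chartBoxImgGLoc L α w S' = Set.univ := by
  refine Set.eq_univ_of_forall fun t => ?_
  obtain ⟨cw, hcw⟩ := (mem_chartTorusGLoc_iff L α w S' hα hS' t.1).1 t.2
  rw [mem_chartBoxImgGLoc_iff]
  refine ⟨fun k => toIcoMod Real.two_pi_pos 0 (cw k), ?_, ?_⟩
  · intro i _
    have hi : ¬ (w ∈ S' ∧ i = 0) := fun h => hw h.1
    show _ ∈ Set.Icc (0 : ℝ) (if w ∈ S' ∧ i = 0 then (1 : ℝ) else 2 * Real.pi)
    rw [if_neg hi]
    have h := toIcoMod_mem_Ico Real.two_pi_pos 0 (cw i)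
    rw [zero_add] at h
    exact ⟨h.1, h.2.le⟩
  · rw [← hcw]
    exact gprimeBlockAt_eq_of_not_mem_of_circleExp_eq L α w S' hw fun k => circleExp_toIcoMod' (cw k)

/-- **At `w ∉ S′` the local torus `T′_{S′,w}` is compact.** [cite: Rogawski1990, §3.6 p. 31] [cite: Shelstad1979, §4 p. 22] -/
theorem compactSpace_chartTorusGLoc_of_not_mem (hα : ∀ i, α i ≠ 0) (hS' : ∀ w, w ∈ S' → w ∈ splitChartPlaces L α) (hw : w ∉ S') :
    CompactSpace ↥(chartTorusGLoc L α w S') :=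
  ⟨by rw [← chartBoxImgGLoc_eq_univ_of_not_mem L α w S' hα hS' hw]; exact isCompact_chartBoxImgGLoc L α w S'⟩

variable [MeasurableSpace ↥(archLocal L 3 (Matrix.diagonal α) w)] [BorelSpace ↥(archLocal L 3 (Matrix.diagonal α) w)]
  (νw : Measure ↥(archLocal L 3 (Matrix.diagonal α) w)) [νw.IsHaarMeasure] [νw.IsMulRightInvariant]

/-- **AT `w ∉ S′` THE LOCAL `G′` FUNCTIONAL IS THE WHOLE-GROUP ORBITAL INTEGRAL**: `chartOrbGLoc L α w S′ ν_w f cw = ∫_{U(α)_w} f(h · gprimeBlockAt cw · h⁻¹) dν_w(h)` for measurable `f`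
(the box prefactor `dt′_w(B′) = dt′_w(T′)` cancels ★ `integral_quotientMeasure_eq_inv_smul` exactly). [cite: Rogawski1990, §8.2 p. 122; §8.3 p. 124] [cite: Folland1995, §2.6 (2.52)]
[cite: DeitmarEchterhoff2014, Cor. 1.5.4] -/
theorem chartOrbGLoc_eq_integral_of_not_mem (hα : ∀ i, α i ≠ 0) (hS' : ∀ w, w ∈ S' → w ∈ splitChartPlaces L α) (hw : w ∉ S')
    (f : ↥(archLocal L 3 (Matrix.diagonal α) w) → ℂ) (hf : Measurable f) (cw : Fin 3 → ℝ) :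
    chartOrbGLoc L α w S' νw f cw = ∫ h, f (h * gprimeBlockAt L α w S' cw * h⁻¹) ∂νw := by
  letI : MeasurableSpace (↥(archLocal L 3 (Matrix.diagonal α) w) ⧸ chartTorusGLoc L α w S') := borel _
  haveI : BorelSpace (↥(archLocal L 3 (Matrix.diagonal α) w) ⧸ chartTorusGLoc L α w S') := ⟨rfl⟩
  haveI := locallyCompactSpace_archLocal_three L α w
  haveI := secondCountableTopology_archLocal_three L α w
  haveI := isHaarMeasure_chartHaarGLoc L α w S'
  haveI := isInvInvariant_chartHaarGLoc L α w S'
  haveI := sigmaFinite_chartHaarGLoc L α w S'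
  haveI := compactSpace_chartTorusGLoc_of_not_mem L α w S' hα hS' hw
  haveI : IsClosed (chartTorusGLoc L α w S' : Set ↥(archLocal L 3 (Matrix.diagonal α) w)) := isClosed_chartTorusGLoc L α w S'
  have hpos : (chartHaarGLoc L α w S' Set.univ).toReal ≠ 0 := by
    rw [← chartBoxImgGLoc_eq_univ_of_not_mem L α w S' hα hS' hw]
    have h0 : 0 < chartHaarGLoc L α w S' (chartBoxImgGLoc L α w S') := by
      rw [chartBoxImgGLoc_eq_univ_of_not_mem L α w S' hα hS' hw]
      exact isOpen_univ.measure_pos _ Set.univ_nonempty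
    exact (ENNReal.toReal_pos h0.ne' (chartHaarGLoc_chartBoxImgGLoc_lt_top L α w S').ne).ne'
  rw [chartOrbGLoc_def]
  show ((chartHaarGLoc L α w S' (chartBoxImgGLoc L α w S')).toReal : ℂ) *
      ∫ x, descConj (gprimeBlockAt L α w S' cw) (chartTorusGLoc L α w S') (forall_mem_chartTorusGLoc_comm L α w S' cw) f x
        ∂(quotientMeasure (chartTorusGLoc L α w S') (chartHaarGLoc L α w S') (isClosed_chartTorusGLoc L α w S') νw) = _
  rw [integral_quotientMeasure_eq_inv_smul (chartTorusGLoc L α w S') (chartHaarGLoc L α w S') νw _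
      (measurable_descConj (gprimeBlockAt L α w S' cw) (chartTorusGLoc L α w S') (forall_mem_chartTorusGLoc_comm L α w S' cw) hf).stronglyMeasurable,
    chartBoxImgGLoc_eq_univ_of_not_mem L α w S' hα hS' hw, measureReal_def, Complex.real_smul, Complex.ofReal_inv, ← mul_assoc,
    mul_inv_cancel₀ (Complex.ofReal_ne_zero.mpr hpos), one_mul]
  simp only [descConj_mk]

end CompactPlace

end Literature.NumberTheory.Automorphic.UnitaryGroup

end
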